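import Literature.AnabelianGeometry.EtaleTheta.SettingModelKummerCocycleP
import Literature.AnabelianGeometry.EtaleTheta.SettingModelCycEquivContinuous
import HarnessLib

/-!
# Continuity of the `Ẑ`-valued Kummer cocycles `κ_x`, `κ_p`, `κ_q : G_{ℚ_p} → Ẑ` (Krull topology on `G_{ℚ_p}`,
# profinite topology on `Ẑ`) — R78 cluster of the abc-iut cell, proof-only sibling of F3c / F3c-2

J. Neukirch, *Algebraic Number Theory*, Ch. IV §1 (Krull topology) and §3 (Kummer theory): the Kummer cocycle
`σ ↦ σ(a^{1/n})/a^{1/n}` is continuous for the Krull topology since it factors through the finite quotient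
`Gal(K(μ_n, a^{1/n})/K)` [cite: NeukirchANT1999, Ch. IV §3].

abc-iut cell, layer L2, seat abc-iut-L2-t5 (gen 5).  PROOF-ONLY (0 definitions): abc-iut-w5-d171's
`ZHatLevel.continuous_of_isLocallyConstant_level` (a map into `Ẑ` whose level characters are locally constant is
continuous; `SettingModelCycEquivContinuous`, p-landed) applied to F3c-2's `isLocallyConstant_level_kummerZH` /
`isLocallyConstant_level_kappaP` and F3c's `isLocallyConstant_level_kappaQ`.  Consumer: abc-iut-L2-t6's
`continuous_sectionχ (hfc : Continuous f)` (`SettingModelChiTwistedSections`) at `f := kappaP p`, `kummerZH x hu`, and the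
powers `κ_p^i` entering the stage-2 pair `((κ_p)⁻¹, κ_p²)`.  A model is consistency evidence only; nothing here bears
on [IUTchIII] Cor. 3.12.
-/

noncomputable section

open CategoryTheory ProfiniteGrp ProfiniteGrp.ProfiniteCompletion

namespace Literature.AnabelianGeometry.EtaleTheta.SettingModel

open Literature.AnabelianGeometry.SemiGraphs (GQp)

variable (p : ℕ) [Fact p.Prime]

/-- **The `Ẑ`-valued Kummer cocycle of any root system of any `G_{ℚ_p}`-fixed unit is continuous.**
[cite: NeukirchANT1999, Ch. IV §3] -/
theorem continuous_kummerZH {u : (PadicAlgCl p)ˣ} (x : RootSystem u)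
    (hu : u ∈ MulAction.fixedPoints (⊤ : Subgroup (GQp p)) (PadicAlgCl p)ˣ) : Continuous (kummerZH x hu) :=
  ZHatLevel.continuous_of_isLocallyConstant_level _ (isLocallyConstant_level_kummerZH x hu)

/-- **`κ_p : G_{ℚ_p} → Ẑ` is continuous.** [cite: NeukirchANT1999, Ch. IV §3] -/
theorem continuous_kappaP : Continuous (kappaP p) :=
  continuous_kummerZH p (pRoots p) (pUnit_mem_fixedPoints p)

/-- **`κ_q : G_{ℚ_p} → Ẑ` is continuous** (F3c's `kappaQ`, root system `qRoots p`). [cite: NeukirchANT1999, Ch. IV §3] -/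
theorem continuous_kappaQ : Continuous (kappaQ p) :=
  ZHatLevel.continuous_of_isLocallyConstant_level _ (isLocallyConstant_level_kappaQ p)

/-- The powers `σ ↦ κ_p(σ)^i` (`i : ℤ`; `i = 2`: `κ(q_X)`, `i = −1`: the inner parameter `[m] = −κ(q̈)`) are continuous.
[cite: NeukirchANT1999, Ch. IV §3] -/
theorem continuous_kappaP_zpow (i : ℤ) : Continuous fun σ : GQp p => kappaP p σ ^ i :=
  (continuous_kappaP p).zpow i

/-- The powers `σ ↦ κ_x(σ)^i` of the generic cocycle are continuous. [cite: NeukirchANT1999, Ch. IV §3] -/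
theorem continuous_kummerZH_zpow {u : (PadicAlgCl p)ˣ} (x : RootSystem u)
    (hu : u ∈ MulAction.fixedPoints (⊤ : Subgroup (GQp p)) (PadicAlgCl p)ˣ) (i : ℤ) :
    Continuous fun σ : GQp p => kummerZH x hu σ ^ i :=
  (continuous_kummerZH p x hu).zpow i

/-- The pair `σ ↦ ((κ_p σ)^i, (κ_p σ)^j) : G_{ℚ_p} → Ẑ × Ẑ` (the `left` part of F3c-2's `cocyclePairHom`) is continuous.
[cite: NeukirchANT1999, Ch. IV §3] -/
theorem continuous_kappaP_zpow_prod (i j : ℤ) : Continuous fun σ : GQp p => (kappaP p σ ^ i, kappaP p σ ^ j) :=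
  (continuous_kappaP_zpow p i).prodMk (continuous_kappaP_zpow p j)

end Literature.AnabelianGeometry.EtaleTheta.SettingModel

end
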